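import Summits.ValiantsHypothesis.ValiantsHypothesis.Theorems.LacunarySymmetroidMatrixDescartesCensusV19CSoundRows

/-!
# `MatrixDescartes` census — soundness of the CASE-C checker: the accumulated Farkas product over `22` slots, LP certificates, competitor bounds

HONEST FRAMING.  Object-search cell `pub-symmetroid`; door-A item `DoorA26 = PosRootLawAt 2 6 19`
(stmt-ValiantsHypothesis-19979; OPEN, typed, never asserted).  Part of the proof that certificates accepted by `V19C.checkSupport` (`…CensusV19CCheck`)
exclude a nineteen on a one-collision support (semantics: `…CensusV19CModel`).  Abstract layer, continued: `V19C.accumulate` (the `22`-slot twin of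
`V20.accumulate`), `lpOK`, `compOK`.  Nothing here bears on the `2`-Sidon supports, on `ζ_sym(2,6)` over all supports, on `DoorA26` itself, on
`MatrixDescartes` (stmt-ValiantsHypothesis-18050) or on `VP ≠ VNP`.

[folklore] Certificate-checker soundness; elementary.
-/

-- the D-0017 layout repeats a namespace component (single-conjunct summit); the `dupNamespace` linter flags it; name mandated.
set_option linter.dupNamespace false

namespace Summit.ValiantsHypothesis.ValiantsHypothesis.Theorems.LacunarySymmetroidMatrixDescartes.Census.V19C

open V20 (Atom allAtoms psum posOf qA cA Term PolySpec posl oddTrues FNat fval Row rowC25 rowOne rowAmgm FRat negAt bumps mulF divF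
  numZ denZ G3poly RCSpoly Wpoly tval pval lprod xpow xpowAux frval BPos lprod_pos atoms_valid coeff_ne_zero qA_mem cA_mem term_getD_mem
  fval_singleton fval_pos xpow_bumps length_bumps xpowAux_replicate_zero frval_nil frval_mulF frval_divF frval_eq_numZ_div_denZ)

section Farkas

open Finset

variable {c : Ctx} {x : ℕ → ℝ} {v : Atom → ℝ}

/-- Semantics of the accumulation over `22` slots: the count vectors carry the monomials, the factored rational carries the constants,
and the rows multiply up (twin of `V20.accumulate_spec`). [folklore] -/
theorem accumulate_spec (hx : ∀ t, 0 < x t) (rs : List (Row × ℕ))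
    (hrs : ∀ rn ∈ rs, Row.Holds x rn.1 ∧ RowWF rn.1) :
    ∀ (acc : List ℕ × List ℕ × FRat), acc.1.length = 22 → acc.2.1.length = 22 → BPos acc.2.2 →
      let res := rs.foldl (fun acc rn =>
        (bumps acc.1 rn.1.L rn.2, bumps acc.2.1 rn.1.R rn.2, divF (mulF acc.2.2 rn.1.Bden rn.2) rn.1.Bnum rn.2)) acc
      res.1.length = 22 ∧ res.2.1.length = 22 ∧ BPos res.2.2 ∧
        ∃ PL PR Cd Cn : ℝ, 0 < PL ∧ 0 < Cn ∧ 0 < Cd ∧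
          xpow x res.1 = xpow x acc.1 * PL ∧ xpow x res.2.1 = xpow x acc.2.1 * PR ∧
          frval res.2.2 = frval acc.2.2 * (Cd / Cn) ∧ PL * Cd ≤ PR * Cn := by
  induction rs with
  | nil =>
    intro acc h1 h2 h3
    exact ⟨h1, h2, h3, 1, 1, 1, 1, one_pos, one_pos, one_pos, by simp, by simp, by simp, le_rfl⟩
  | cons rn rs ih =>
    intro acc h1 h2 h3
    obtain ⟨⟨hold, hL, hR, hBn, hBd⟩, hrest⟩ :
        (Row.Holds x rn.1 ∧ RowWF rn.1) ∧ ∀ rn' ∈ rs, Row.Holds x rn'.1 ∧ RowWF rn'.1 :=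
      ⟨hrs rn (by simp), fun rn' h => hrs rn' (by simp [h])⟩
    rw [List.foldl_cons]
    set acc' : List ℕ × List ℕ × FRat :=
      (bumps acc.1 rn.1.L rn.2, bumps acc.2.1 rn.1.R rn.2, divF (mulF acc.2.2 rn.1.Bden rn.2) rn.1.Bnum rn.2) with hacc'
    have hm := frval_mulF hBd rn.2 h3
    have hd := frval_divF hBn rn.2 hm.2
    have h1' : acc'.1.length = 22 := by rw [hacc']; simp only; rw [length_bumps]; exact h1
    have h2' : acc'.2.1.length = 22 := by rw [hacc']; simp only; rw [length_bumps]; exact h2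
    obtain ⟨r1, r2, r3, PL, PR, Cd, Cn, hPL, hCn, hCd, e1, e2, e3, hle⟩ := ih hrest acc' h1' h2' hd.2
    refine ⟨r1, r2, r3, lprod x rn.1.L ^ rn.2 * PL, lprod x rn.1.R ^ rn.2 * PR,
      (fval rn.1.Bden : ℝ) ^ rn.2 * Cd, (fval rn.1.Bnum : ℝ) ^ rn.2 * Cn, ?_, ?_, ?_, ?_, ?_, ?_, ?_⟩
    · exact mul_pos (pow_pos (lprod_pos hx _) _) hPL
    · exact mul_pos (pow_pos (by exact_mod_cast fval_pos hBn) _) hCn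
    · exact mul_pos (pow_pos (by exact_mod_cast fval_pos hBd) _) hCd
    · rw [e1, hacc']; simp only
      rw [xpow_bumps x _ _ _ (fun p hp => by rw [h1]; exact hL p hp)]; ring
    · rw [e2, hacc']; simp only
      rw [xpow_bumps x _ _ _ (fun p hp => by rw [h2]; exact hR p hp)]; ring
    · rw [e3, hacc']; simp only
      rw [hd.1, hm.1]
      have : (fval rn.1.Bnum : ℝ) ^ rn.2 ≠ 0 := pow_ne_zero _ (by exact_mod_cast (fval_pos hBn).ne')
      field_simp
    · have hrow : lprod x rn.1.L ^ rn.2 * (fval rn.1.Bden : ℝ) ^ rn.2 ≤ lprod x rn.1.R ^ rn.2 * (fval rn.1.Bnum : ℝ) ^ rn.2 := by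
        rw [← mul_pow, ← mul_pow]
        exact pow_le_pow_left₀ (mul_nonneg (lprod_pos hx _).le (by positivity)) hold _
      calc lprod x rn.1.L ^ rn.2 * PL * ((fval rn.1.Bden : ℝ) ^ rn.2 * Cd)
          = (lprod x rn.1.L ^ rn.2 * (fval rn.1.Bden : ℝ) ^ rn.2) * (PL * Cd) := by ring
        _ ≤ (lprod x rn.1.R ^ rn.2 * (fval rn.1.Bnum : ℝ) ^ rn.2) * (PR * Cn) :=
          mul_le_mul hrow hle (mul_nonneg hPL.le hCd.le)
            (mul_nonneg (pow_nonneg (lprod_pos hx _).le _) (by positivity))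
        _ = lprod x rn.1.R ^ rn.2 * PR * ((fval rn.1.Bnum : ℝ) ^ rn.2 * Cn) := by ring

/-- `accumulate` unfolded. [folklore] -/
theorem accumulate_eq_foldl (rs : List (Row × ℕ)) :
    accumulate rs = rs.foldl (fun acc rn =>
      (bumps acc.1 rn.1.L rn.2, bumps acc.2.1 rn.1.R rn.2, divF (mulF acc.2.2 rn.1.Bden rn.2) rn.1.Bnum rn.2))
      (zero22, zero22, []) := rfl

/-- All built rows hold and are well formed. [folklore] -/
theorem buildRows_sound (M : Model c x v) :
    ∀ (specs : List (RowSpec × ℕ)) (rs : List (Row × ℕ)), buildRows c specs = some rs →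
      ∀ rn ∈ rs, Row.Holds x rn.1 ∧ RowWF rn.1
  | [], rs, h => by simp [buildRows] at h; subst h; simp
  | (sp, n) :: specs, rs, h => by
    simp only [buildRows] at h
    split at h
    · next r rr hr hrr =>
      cases h
      intro rn hrn
      simp only [List.mem_cons] at hrn
      rcases hrn with rfl | hrn
      · exact buildRow_sound M hr
      · exact buildRows_sound M specs rr hrr rn hrn
    · cases h

/-- The Farkas product of accepted rows: monomial parts and the constant ratio. [folklore] -/
theorem accumulate_sound (M : Model c x v) {specs : List (RowSpec × ℕ)} {rs : List (Row × ℕ)}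
    (h : buildRows c specs = some rs) :
    (accumulate rs).1.length = 22 ∧ (accumulate rs).2.1.length = 22 ∧ BPos (accumulate rs).2.2 ∧
      ∃ PL PR Cd Cn : ℝ, 0 < PL ∧ 0 < Cn ∧ 0 < Cd ∧
        xpow x (accumulate rs).1 = PL ∧ xpow x (accumulate rs).2.1 = PR ∧
        frval (accumulate rs).2.2 = Cd / Cn ∧ PL * Cd ≤ PR * Cn := by
  have := accumulate_spec M.xpos rs (buildRows_sound M specs rs h) (zero22, zero22, [])
    (by simp [zero22]) (by simp [zero22]) (by intro bz h; simp at h)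
  rw [accumulate_eq_foldl]
  obtain ⟨r1, r2, r3, PL, PR, Cd, Cn, hPL, hCn, hCd, e1, e2, e3, hle⟩ := this
  refine ⟨r1, r2, r3, PL, PR, Cd, Cn, hPL, hCn, hCd, ?_, ?_, ?_, hle⟩
  · rw [e1, show xpow x (zero22, zero22, ([] : FRat)).1 = 1 from xpowAux_replicate_zero x 22 0, one_mul]
  · rw [e2, show xpow x (zero22, zero22, ([] : FRat)).2.1 = 1 from xpowAux_replicate_zero x 22 0, one_mul]
  · rw [e3, show frval (zero22, zero22, ([] : FRat)).2.2 = 1 from frval_nil, one_mul]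

/-! ### LP certificates -/

/-- An accepted Farkas certificate refutes the model. [folklore] -/
theorem lpOK_sound (M : Model c x v) {specs : List (RowSpec × ℕ)} (h : lpOK c specs = true) : False := by
  unfold lpOK at h
  split at h
  · simp at h
  · next rs hrs =>
    simp only [Bool.and_eq_true, decide_eq_true_eq] at h
    obtain ⟨hbal, hlt⟩ := h
    obtain ⟨-, -, hB, PL, PR, Cd, Cn, hPL, hCn, hCd, e1, e2, e3, hle⟩ := accumulate_sound M hrs
    have hPLR : PL = PR := by rw [← e1, ← e2, hbal]
    have hratio : Cd ≤ Cn := le_of_mul_le_mul_left (a := PL) (by rw [hPLR] at hle ⊢; exact hle) hPL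
    obtain ⟨hf, hden⟩ := frval_eq_numZ_div_denZ hB
    rw [e3] at hf
    have hdenR : (0 : ℝ) < denZ (accumulate rs).2.2 := by exact_mod_cast hden
    have h1 : Cd / Cn ≤ 1 := (div_le_one hCn).2 hratio
    rw [hf] at h1
    have h2 : (numZ (accumulate rs).2.2 : ℝ) ≤ denZ (accumulate rs).2.2 := by
      rwa [div_le_one hdenR] at h1
    have h3 : numZ (accumulate rs).2.2 ≤ denZ (accumulate rs).2.2 := by exact_mod_cast h2
    omega

/-! ### Domination certificates: one competitor -/

/-- One competitor: the bound `|t_k| · ud ≤ un · |t₀|` (terms `k`, `n0` without the zero atom). [folklore] -/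
theorem compOK_sound (M : Model c x v) {P : PolySpec} (hval : P.valid = true) {n0 ud : ℕ}
    (hn0 : n0 < P.poly.length) (hz0 : termZero c (P.poly.getD n0 (0, [])) = false) (hud : 0 < ud) {cp : Comp}
    (hk : cp.k < P.poly.length) (hzk : termZero c (P.poly.getD cp.k (0, [])) = false)
    (h : compOK c P.poly n0 ud cp = true) :
    |tval v (P.poly.getD cp.k (0, []))| * ud ≤ cp.un * |tval v (P.poly.getD n0 (0, []))| := by
  unfold compOK at h
  split at h
  · simp at h
  · next rs hrs =>
    simp only [Bool.and_eq_true, decide_eq_true_eq] at h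
    obtain ⟨⟨⟨hD, hun⟩, hbal⟩, hle⟩ := h
    obtain ⟨hl1, hl2, hB, PL, PR, Cd, Cn, hPL, hCn, hCd, e1, e2, e3, hrow⟩ := accumulate_sound M hrs
    have hT0a := atoms_valid P hval _ (term_getD_mem P.poly hn0)
    have hTka := atoms_valid P hval _ (term_getD_mem P.poly hk)
    have hg0 : (P.poly.getD n0 (0, [])).1 ≠ 0 := coeff_ne_zero P _ (term_getD_mem P.poly hn0)
    have hgk : (P.poly.getD cp.k (0, [])).1 ≠ 0 := coeff_ne_zero P _ (term_getD_mem P.poly hk)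
    rw [abs_tval_eq M _ hT0a hz0, abs_tval_eq M _ hTka hzk]
    set G0 : ℝ := |((P.poly.getD n0 (0, [])).1 : ℝ)| with hG0
    set Gk : ℝ := |((P.poly.getD cp.k (0, [])).1 : ℝ)| with hGk
    set m0 := lprod x (posl c.ordS (P.poly.getD n0 (0, [])).2) with hm0
    set mk := lprod x (posl c.ordS (P.poly.getD cp.k (0, [])).2) with hmk
    have hm0p : 0 < m0 := lprod_pos M.xpos _
    have hmkp : 0 < mk := lprod_pos M.xpos _
    have hG0p : 0 < G0 := by rw [hG0]; exact abs_pos.2 (by exact_mod_cast hg0)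
    have hGkp : 0 < Gk := by rw [hGk]; exact abs_pos.2 (by exact_mod_cast hgk)
    have hudR : (0 : ℝ) < ud := by exact_mod_cast hud
    have hunR : (0 : ℝ) < cp.un := by exact_mod_cast hun
    have hbal' : PL * m0 ^ cp.D = PR * mk ^ cp.D := by
      have h1 := xpow_bumps x (accumulate rs).1 (posl c.ordS (P.poly.getD n0 (0, [])).2) cp.D
        (fun p hp => by rw [hl1]; exact posl_lt_22 M hT0a p hp)
      have h2 := xpow_bumps x (accumulate rs).2.1 (posl c.ordS (P.poly.getD cp.k (0, [])).2) cp.D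
        (fun p hp => by rw [hl2]; exact posl_lt_22 M hTka p hp)
      rw [← e1, ← e2, ← h1, ← h2, hbal]
    have hb1 : ∀ be ∈ [(cp.un * (P.poly.getD n0 (0, [])).1.natAbs, cp.D)], 0 < be.1 := by
      intro be hbe; simp only [List.mem_singleton] at hbe; subst hbe
      exact Nat.mul_pos hun (Int.natAbs_pos.2 hg0)
    have hb2 : ∀ be ∈ [((P.poly.getD cp.k (0, [])).1.natAbs * ud, cp.D)], 0 < be.1 := by
      intro be hbe; simp only [List.mem_singleton] at hbe; subst hbe
      exact Nat.mul_pos (Int.natAbs_pos.2 hgk) hud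
    have hm := frval_mulF hb1 1 hB
    have hd := frval_divF hb2 1 hm.2
    obtain ⟨hf, hden⟩ := frval_eq_numZ_div_denZ hd.2
    have hdenR : (0 : ℝ) < denZ (divF (mulF (accumulate rs).2.2 [(cp.un * (P.poly.getD n0 (0, [])).1.natAbs, cp.D)] 1)
        [((P.poly.getD cp.k (0, [])).1.natAbs * ud, cp.D)] 1) := by exact_mod_cast hden
    have hge : (1 : ℝ) ≤ frval (divF (mulF (accumulate rs).2.2 [(cp.un * (P.poly.getD n0 (0, [])).1.natAbs, cp.D)] 1)
        [((P.poly.getD cp.k (0, [])).1.natAbs * ud, cp.D)] 1) := by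
      rw [hf, le_div_iff₀ hdenR, one_mul]; exact_mod_cast hle
    rw [hd.1, hm.1, e3, fval_singleton, fval_singleton, pow_one, pow_one] at hge
    push_cast at hge
    rw [Nat.cast_natAbs, Int.cast_abs, Nat.cast_natAbs, Int.cast_abs] at hge
    have hX : 0 < (Gk * ud) ^ cp.D := by positivity
    have hi : Cn * (Gk * ud) ^ cp.D ≤ Cd * (cp.un * G0) ^ cp.D := by
      have := hge
      rw [le_div_iff₀ hX, one_mul, div_mul_eq_mul_div, le_div_iff₀ hCn] at this
      linarith
    have hii : PL * (Gk * ud) ^ cp.D ≤ PR * (cp.un * G0) ^ cp.D := by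
      have h1 : PL * (Cn * (Gk * ud) ^ cp.D) ≤ PL * (Cd * (cp.un * G0) ^ cp.D) := mul_le_mul_of_nonneg_left hi hPL.le
      have h2 : PL * Cd * (cp.un * G0) ^ cp.D ≤ PR * Cn * (cp.un * G0) ^ cp.D :=
        mul_le_mul_of_nonneg_right hrow (by positivity)
      nlinarith
    have hiii : (mk * Gk * ud) ^ cp.D ≤ (m0 * cp.un * G0) ^ cp.D := by
      have h1 : PL * mk ^ cp.D * (Gk * ud) ^ cp.D ≤ PR * mk ^ cp.D * (cp.un * G0) ^ cp.D := by
        nlinarith [pow_pos hmkp cp.D]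
      rw [show PR * mk ^ cp.D = PL * m0 ^ cp.D from hbal'.symm] at h1
      have h1' : PL * (mk ^ cp.D * (Gk * ud) ^ cp.D) ≤ PL * (m0 ^ cp.D * (cp.un * G0) ^ cp.D) := by linarith
      have h2 : mk ^ cp.D * (Gk * ud) ^ cp.D ≤ m0 ^ cp.D * (cp.un * G0) ^ cp.D := le_of_mul_le_mul_left h1' hPL
      simp only [mul_pow] at h2 ⊢
      linarith
    have hfin : mk * Gk * ud ≤ m0 * cp.un * G0 :=
      (pow_le_pow_iff_left₀ (by positivity) (by positivity) (by omega)).1 hiii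
    nlinarith

end Farkas

end Summit.ValiantsHypothesis.ValiantsHypothesis.Theorems.LacunarySymmetroidMatrixDescartes.Census.V19C
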